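import Summits.Ventures.QEC.Census.CertCoverChecks
import Summits.Ventures.QEC.Census.CertBZList
import Summits.Ventures.QEC.Census.CertCheckParityFast
import HarnessLib

/-!
# Cover reduction — the ASSEMBLY theorems, parametric in the certificate's verdicts (no data)
# (director-qec R29/R37 (d) ε lane: qec-search-9 data/emitter, qec-type-10 assembly; census/search-9/cover/README §3)

`Census/CertCover*.lean` (qec-search-9) prove the per-piece lemmas of the two-sheeted cover reduction on words:
fibre decomposition (`CertCover`), syndrome descent (`CertCoverSyndrome`), the coset checker `cosetOK` and its
soundness (`CertCoverCoset`), the per-problem LEVEL lemmas `level_label_core` / `level_list_core` (`CertCoverLevel`),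
transport of solved problems along cover-compatible automorphisms `liftOK_transport[2]` (`CertCoverOrbit`, on type-12's
`CertCoverTransport`), witness tables and generator push-forwards (`CertCoverChecks`); `Census/CertBZList` (type-10) is the
list-complete Brouwer–Zimmermann enumeration for LEVEL 2. This file composes them ONCE into the statements a per-code
file instantiates — every hypothesis is either a `decide`-able verdict of a data module or one of the tree's structural facts:

* `BadLe c HX HZ W v` — the words the whole argument is about: `v < 2^n`, `H^X v = 0`, `v ∉ rowspace H^Z`, `|v| ≤ W`
  (a non-trivial `Z`-logical of weight `≤ W`, as a word); `NoBadOver c HX HZ W u` — «no such word pushes forward to `u`»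
  (verbatim the `hrep` shape of `liftOK_transport`).
* **`hLab_of_core`** — L1 upstairs in the form the label level needs: from type-10's core structural verdict
  (`bzCoreOK`: rank certificates, pairing, `n = r_X + r_Z + k`) every `v ∈ ker H^X` whose `k` dual parities
  `⟨LX_i, v⟩` all vanish lies in `rowspace H^Z` (CertLogical `exists_coeffs_of_ker` + AutomorphismLabelAction
  `mem_rowSpZ_iff_label_eq_zero`).
* **`noBadOver_of_levelLabel`** (T0) — a solved LEVEL-1→0 problem of the representative `u` (`level_label_core` with
  `Λ :=` the dual words `LXd`) + `hLab` ⇒ `NoBadOver … u`.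
* **`flat_of_cover`** (T1) — `NoBadOver 0`, `NoBadOver rep_j` for every listed representative, a candidate list covering
  the push-forwards of all bad words, compatible automorphism pairs with their row maps, and the two witness tables
  (`witnessOK`, `coveredOK`) ⇒ NO bad word of weight `≤ W` exists: `∀ v < 2^n, H^X v = 0 → v ∉ rs H^Z → W < |v|` — for
  `[[288,12,18]]` (`W = 16`) exactly the hypothesis of `Theorems/BB288DistanceCertificateLowerZOfFlat` (p500427) after
  `ofBits`.
The level-2 / level-2→1 composition that PRODUCES the candidate cover (`hcov`) from `bz_list_sound`, `level_list_core`
and `liftOK_transport2` is stated with the data layout of search-9's emitter (v1 JSON) in the per-code file or a sibling.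
Tier KERNEL, axioms standard; nothing is evaluated here.
-/

namespace Summit.Ventures.QEC.Census

open Matrix Literature.InformationTheory.QuantumCodes

/-! ## The two predicates -/

/-- A «bad word of weight `≤ W`»: a word `v < 2^n` with zero `H^X`-syndrome, outside `rowspace H^Z`, of weight `≤ W`
(a non-trivial `Z`-logical the certificate must exclude). (definition) -/
def BadLe (c : Cover2) (HX HZ : List ℕ) (W v : ℕ) : Prop :=
  v < 2 ^ c.n ∧ synZero c.n HX v = true ∧ ofBits c.n v ∉ rowSpace (rowMatrix c.n HZ) ∧ popc c.n v ≤ W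

/-- «No bad word of weight `≤ W` pushes forward to `u`» — the per-`u` statement the level and transport lemmas
produce and consume (`hrep` of `liftOK_transport`). (definition) -/
def NoBadOver (c : Cover2) (HX HZ : List ℕ) (W u : ℕ) : Prop :=
  ∀ v : ℕ, v < 2 ^ c.n → synZero c.n HX v = true → ofBits c.n v ∉ rowSpace (rowMatrix c.n HZ) →
    popc c.n v ≤ W → c.push v ≠ u

/-! ## L1 upstairs, label form: all dual parities even ⇒ stabilizer -/

section Label

variable {n : ℕ} {HX HZ : List ℕ} {rcX rcZ : RankCert} {LZ LXd : List ℕ} {ew : Option (List ℕ)}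

/-- The `i`-th dual parity of a word is the `i`-th coordinate of `ldMat *ᵥ ofBits v`. -/
theorem ldMat_mulVec_ofBits_apply (n : ℕ) (L Ld : List ℕ) (v : ℕ) (i : Fin L.length) :
    (ldMat n L Ld *ᵥ ofBits n v) i = (popc n (Ld.getD i 0 &&& v) : ZMod 2) := by
  change ofBits n (Ld.getD i 0) ⬝ᵥ ofBits n v = _
  exact ofBits_dotProduct n _ v

/-- **L1, label form, from the core structural verdict** (`bzCoreOK n HX HZ rcX rcZ LZ LXd ew`, side `Z`: syndromes `H^X`,
stabilizers `H^Z`, generators `LZ`, duals `LXd`): a word `v` with `H^X v = 0` all of whose dual parities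
`popc (LXd[i] &&& v)` are even lies in `rowspace H^Z`. -/
theorem hLab_of_core (hcomm : rowMatrix n HX * (rowMatrix n HZ)ᵀ = 0)
    (hcore : bzCoreOK n HX HZ rcX rcZ LZ LXd ew = true) {v : ℕ} (hsyn : synZero n HX v = true)
    (heven : ∀ i : ℕ, i < LZ.length → popc n (LXd.getD i 0 &&& v) % 2 = 0) :
    ofBits n v ∈ rowSpace (rowMatrix n HZ) := by
  have hcore' := hcore
  simp only [bzCoreOK, Bool.and_eq_true, beq_iff_eq] at hcore'
  obtain ⟨⟨⟨⟨hY, hS⟩, hL⟩, hdim⟩, -⟩ := hcore'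
  let C := CSSCode.ofMatrices (rowMatrix n HX) (rowMatrix n HZ) hcomm
  let LXm : Matrix (Fin LZ.length) (Fin n) (ZMod 2) := ldMat n LZ LXd
  let LZm : Matrix (Fin LZ.length) (Fin n) (ZMod 2) := fun i => logVec n LZ i
  have hpair : LXm * LZmᵀ = 1 := by
    ext j i
    rw [Matrix.mul_apply', Matrix.one_apply]
    change ofBits n (LXd.getD j 0) ⬝ᵥ logVec n LZ i = _
    rw [dual_dotProduct_logVec hL i j]
    by_cases h : i = j
    · subst h; simp
    · rw [if_neg h, if_neg (fun e => h e.symm)]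
  have hLX : ∀ a, C.HZ *ᵥ LXm a = 0 := fun a => mulVec_dual_eq_zero hL a
  have hexp : ∀ z, C.HX *ᵥ z = 0 → z - (LXm *ᵥ z) ᵥ* LZm ∈ C.rowSpZ := fun z hz =>
    C.sub_label_vecMul_mem_rowSpZ hLX hpair (exists_coeffs_of_ker hcomm hY hS hL hdim hz)
  have hz : C.HX *ᵥ ofBits n v = 0 := (synZero_iff _ _ _).1 hsyn
  refine (C.mem_rowSpZ_iff_label_eq_zero hLX hexp hz).2 ?_
  funext i
  rw [ldMat_mulVec_ofBits_apply, Pi.zero_apply, natCast_zmod2_eq_zero_iff]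
  exact heven i i.2

end Label

/-! ## T0: a solved level-1→0 problem closes its representative -/

/-- **T0.** If the LEVEL-1→0 problem of the representative `u` is solved (hypotheses of `level_label_core` with the
functionals `Λ :=` the dual words `LXd`, the BU-evenness and the allow-list label check as Bool verdicts) and L1 holds
upstairs in label form (`hLab`, e.g. `hLab_of_core`), then no bad word of weight `≤ W` pushes forward to `u`. -/
theorem noBadOver_of_levelLabel {c cr : Cover2} (hc : c.ok = true) (hcr : cr.ok = true) {HX HZ Hq Dq LXd : List ℕ}
    (hrows : pushRowsOK c cr HX Hq = true)
    (hDq : ∀ z : Fin c.nq → ZMod 2, rowMatrix c.nq Hq *ᵥ z = 0 →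
      z ∈ Submodule.span (ZMod 2) (Set.range fun i : Fin Dq.length => ofBits c.nq Dq[i]))
    {P : CosetProb} (hP : cosetOK c.nq Hq Dq P = true) {u W : ℕ} (hU : P.U = u) (hσ : P.sigma = sigmaOf c cr HX u)
    (hf : W ≤ 2 * P.f + popc c.nq u) (hBU : buEvenOK c P LXd = true) (hallow : labelCheckOK c P u LXd = true)
    {k : ℕ} (hk : LXd.length = k)
    (hLab : ∀ v : ℕ, synZero c.n HX v = true → (∀ i : ℕ, i < k → popc c.n (LXd.getD i 0 &&& v) % 2 = 0) →
      ofBits c.n v ∈ rowSpace (rowMatrix c.n HZ)) :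
    NoBadOver c HX HZ W u := by
  intro v hv hsyn hnot hwt hpu
  apply hnot
  refine hLab v hsyn fun i hi => ?_
  have hmem : LXd.getD i 0 ∈ LXd := by
    rw [List.getD_eq_getElem?_getD, List.getElem?_eq_getElem (by rw [hk]; exact hi), Option.getD_some]
    exact List.getElem_mem _
  exact level_label_core hc hcr hrows hDq hP hU hσ hf LXd (hBU_of_buEvenOK hBU) (hallow_of_labelCheckOK hallow) hv hsyn
    hpu hwt _ hmem

/-! ## T1: from the solved representatives, the transports and the witness tables to «no bad word at all» -/

/-- The automorphism data of a cover step as parallel lists: upstairs tables `perms[i]`, downstairs tables `permqs[i]`,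
row maps `rowsX[i]` / `rowsZ[i]`; the check: every entry is cover-compatible and a row-map automorphism of both check
matrices. (definition) -/
def autsCompatOK (c : Cover2) (HX HZ : List ℕ) (perms permqs rowsX rowsZ : List (List ℕ)) : Bool :=
  (perms.length == permqs.length) &&
    (List.range perms.length).all fun i =>
      c.permCompatOK (perms.getD i []) (permqs.getD i []) && rowMapOK c.n HX (perms.getD i []) (rowsX.getD i []) &&
        rowMapOK c.n HZ (perms.getD i []) (rowsZ.getD i [])

/-- **T1 — the flat conclusion from the pieces.** Cover step `c` (tables checked), commuting check words; `0` and every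
listed representative `reps[j]` carry no bad word of weight `≤ W` (`hzero`, `hreps`: from the quotient code's distance
theorem resp. T0); every bad word's push-forward is `0` or in the candidate list `cand` (`hcov`: from LEVEL 2 / 2→1);
every candidate is carried by a listed compatible automorphism to a listed representative (`autsCompatOK`, `witnessOK`,
`coveredOK`). Then NO bad word of weight `≤ W` exists: every word `v < 2^n` with `H^X v = 0` outside `rowspace H^Z` has
weight `> W`. -/
theorem flat_of_cover {c : Cover2} (hc : c.ok = true) {HX HZ : List ℕ}
    (hcomm : rowMatrix c.n HX * (rowMatrix c.n HZ)ᵀ = 0) {W : ℕ}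
    (hzero : NoBadOver c HX HZ W 0)
    {cand : List ℕ} (hcov : ∀ v : ℕ, BadLe c HX HZ W v → c.push v = 0 ∨ c.push v ∈ cand)
    {perms permqs rowsX rowsZ : List (List ℕ)} (hauts : autsCompatOK c HX HZ perms permqs rowsX rowsZ = true)
    {reps : List ℕ} (hreps : ∀ j : ℕ, j < reps.length → NoBadOver c HX HZ W (reps.getD j 0))
    {tab : List CoverWitness} (hw : witnessOK c.nq permqs reps tab = true) (hcw : coveredOK cand tab = true) :
    ∀ v : ℕ, v < 2 ^ c.n → synZero c.n HX v = true → ofBits c.n v ∉ rowSpace (rowMatrix c.n HZ) → W < popc c.n v := by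
  intro v hv hsyn hnot
  by_contra hle
  rw [not_lt] at hle
  rcases hcov v ⟨hv, hsyn, hnot, hle⟩ with h0 | hmem
  · exact hzero v hv hsyn hnot hle h0
  · obtain ⟨i, hi, j, hj, hij⟩ := exists_witness_of_coveredOK hw hcw hmem
    simp only [autsCompatOK, Bool.and_eq_true, beq_iff_eq, List.all_eq_true, List.mem_range] at hauts
    obtain ⟨hlen, hall⟩ := hauts
    obtain ⟨⟨hcompat, hX⟩, hZ⟩ := hall i (by rw [hlen]; exact hi)
    exact liftOK_transport hc hcomm hcompat hX hZ (hreps j hj) hij v hv hsyn hnot hle rfl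

/-! ## T1′: the same with a TRANSPORTED candidate (the shape LEVEL 2 / 2→1 produce) -/

/-- **T1′.** As `flat_of_cover`, but the candidate cover may first replace the bad word by another bad word of weight
`≤ W` (its transport by a composite automorphism): `hcov' : ∀ v bad, ∃ v' bad, push v' = 0 ∨ push v' ∈ cand`. -/
theorem flat_of_cover' {c : Cover2} (hc : c.ok = true) {HX HZ : List ℕ}
    (hcomm : rowMatrix c.n HX * (rowMatrix c.n HZ)ᵀ = 0) {W : ℕ}
    (hzero : NoBadOver c HX HZ W 0)
    {cand : List ℕ}
    (hcov' : ∀ v : ℕ, BadLe c HX HZ W v → ∃ v' : ℕ, BadLe c HX HZ W v' ∧ (c.push v' = 0 ∨ c.push v' ∈ cand))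
    {perms permqs rowsX rowsZ : List (List ℕ)} (hauts : autsCompatOK c HX HZ perms permqs rowsX rowsZ = true)
    {reps : List ℕ} (hreps : ∀ j : ℕ, j < reps.length → NoBadOver c HX HZ W (reps.getD j 0))
    {tab : List CoverWitness} (hw : witnessOK c.nq permqs reps tab = true) (hcw : coveredOK cand tab = true) :
    ∀ v : ℕ, v < 2 ^ c.n → synZero c.n HX v = true → ofBits c.n v ∉ rowSpace (rowMatrix c.n HZ) → W < popc c.n v := by
  intro v hv hsyn hnot
  by_contra hle
  rw [not_lt] at hle
  obtain ⟨v', ⟨hv', hsyn', hnot', hle'⟩, hcase⟩ := hcov' v ⟨hv, hsyn, hnot, hle⟩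
  rcases hcase with h0 | hmem
  · exact hzero v' hv' hsyn' hnot' hle' h0
  · obtain ⟨i, hi, j, hj, hij⟩ := exists_witness_of_coveredOK hw hcw hmem
    simp only [autsCompatOK, Bool.and_eq_true, beq_iff_eq, List.all_eq_true, List.mem_range] at hauts
    obtain ⟨hlen, hall⟩ := hauts
    obtain ⟨⟨hcompat, hX⟩, hZ⟩ := hall i (by rw [hlen]; exact hi)
    exact liftOK_transport hc hcomm hcompat hX hZ (hreps j hj) hij v' hv' hsyn' hnot' hle' rfl

/-! ## T2: LEVEL 2 + LEVEL 2→1 produce the transported candidate cover -/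

/-- The automorphism data through TWO cover steps: triples `(perms[i], permqs[i], permqqs[i])` compatible with `c` and with
`c₂`, row-map automorphisms upstairs. (definition) -/
def autsCompat2OK (c c₂ : Cover2) (HX HZ : List ℕ) (perms permqs permqqs rowsX rowsZ : List (List ℕ)) : Bool :=
  (perms.length == permqs.length) && (perms.length == permqqs.length) &&
    (List.range perms.length).all fun i =>
      c.permCompatOK (perms.getD i []) (permqs.getD i []) && c₂.permCompatOK (permqs.getD i []) (permqqs.getD i []) &&
        rowMapOK c.n HX (perms.getD i []) (rowsX.getD i []) && rowMapOK c.n HZ (perms.getD i []) (rowsZ.getD i [])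

/-- The weight never increases under push-forward. -/
theorem Cover2.popc_push_le {c : Cover2} (h : c.ok = true) (v : ℕ) : popc c.nq (c.push v) ≤ popc c.n v := by
  have := Cover2.popc_eq_push_add_two_dbl h v
  omega

/-- **T2 — the candidate cover from the two lower levels.** Two cover steps `c` (`n → nq`) and `c₂` (`nq → nqq`), commuting
check words upstairs. Hypotheses, each a verdict of the data or a one-line consequence of the generic lemmas:
`hspan2` — the double push-forward of every `H^X`-kernel word lies in the row space of the LEVEL-2 generator rows `Gb2`
(L-M, from `push_of_gens`-style tables); `hl2` — LEVEL 2 list-completeness on that row space (`mem_allow_of_bz_list` on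
`CertBZList.bz_list_sound`): every non-zero word of weight `≤ W` there is in `found2`; `hauts2` + the witness table
`tab2` over `0 :: found2` with representatives `reps2` — composite transports (`liftOK_transport2` shape); `hprob2` — for
every representative `reps2[j]`, the SOLVED LEVEL-2→1 problem in list form (`level_list_core[_aug]` + `mem_listGen`):
every `u < 2^nq` with `Hq u = 0`, the extra parities `Λ` even, `push₂ u = reps2[j]`, `|u| ≤ W` lies in `cand2 j`;
`hpushKer` — the push-forward of a bad word has `Hq`-syndrome zero and even `Λ`-parities (`push_of_gens` with the word
form of L1). Conclusion: every bad word of weight `≤ W` has a TRANSPORT (bad, same weight) whose push-forward lies in the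
union `cand` of the lists `cand2 j` — the `hcov'` of `flat_of_cover'` (with `hsub : cand2 j ⊆ cand`). -/
theorem cov_of_levels {c c₂ : Cover2} (hc : c.ok = true) (hc₂ : c₂.ok = true) (hn : c₂.n = c.nq) {HX HZ Hq : List ℕ}
    (hcomm : rowMatrix c.n HX * (rowMatrix c.n HZ)ᵀ = 0) {W : ℕ} (Lam : List ℕ) {Gb2 found2 : List ℕ}
    (hspan2 : ∀ v : ℕ, v < 2 ^ c.n → synZero c.n HX v = true →
      ofBits c₂.nq (c₂.push (c.push v)) ∈ rowSpace (rowMatrix c₂.nq Gb2))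
    (hl2 : ∀ s : ℕ, s < 2 ^ c₂.nq → ofBits c₂.nq s ∈ rowSpace (rowMatrix c₂.nq Gb2) → s ≠ 0 → popc c₂.nq s ≤ W →
      s ∈ found2)
    {perms permqs permqqs rowsX rowsZ : List (List ℕ)}
    (hauts2 : autsCompat2OK c c₂ HX HZ perms permqs permqqs rowsX rowsZ = true)
    {reps2 : List ℕ} {tab2 : List CoverWitness} (hw2 : witnessOK c₂.nq permqqs reps2 tab2 = true)
    (hcw2 : coveredOK (0 :: found2) tab2 = true)
    (cand2 : ℕ → List ℕ)
    (hprob2 : ∀ j : ℕ, j < reps2.length → ∀ u : ℕ, u < 2 ^ c.nq → synZero c.nq Hq u = true →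
      (∀ l ∈ Lam, popc c.nq (l &&& u) % 2 = 0) → c₂.push u = reps2.getD j 0 → popc c.nq u ≤ W → u ∈ cand2 j)
    (hpushKer : ∀ v : ℕ, v < 2 ^ c.n → synZero c.n HX v = true →
      synZero c.nq Hq (c.push v) = true ∧ ∀ l ∈ Lam, popc c.nq (l &&& c.push v) % 2 = 0)
    {cand : List ℕ} (hsub : ∀ j : ℕ, j < reps2.length → ∀ u ∈ cand2 j, u ∈ cand) :
    ∀ v : ℕ, BadLe c HX HZ W v → ∃ v' : ℕ, BadLe c HX HZ W v' ∧ (c.push v' = 0 ∨ c.push v' ∈ cand) := by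
  rintro v ⟨hv, hsyn, hnot, hle⟩
  -- LEVEL 2: the double push-forward is 0 or listed
  set s := c₂.push (c.push v) with hs
  have hslt : s < 2 ^ c₂.nq := c₂.push_lt _
  have hsw : popc c₂.nq s ≤ W :=
    le_trans (Cover2.popc_push_le hc₂ _) (le_trans (by rw [hn]; exact Cover2.popc_push_le hc v) hle)
  have hsmem : s ∈ (0 :: found2) := by
    by_cases h0 : s = 0
    · rw [h0]; exact List.mem_cons_self
    · exact List.mem_cons_of_mem _ (hl2 s hslt (hspan2 v hv hsyn) h0 hsw)
  -- witness: a compatible triple carries s to a representative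
  obtain ⟨i, hi, j, hj, hij⟩ := exists_witness_of_coveredOK hw2 hcw2 hsmem
  simp only [autsCompat2OK, Bool.and_eq_true, beq_iff_eq, List.all_eq_true, List.mem_range] at hauts2
  obtain ⟨⟨hlen1, hlen2⟩, hall⟩ := hauts2
  obtain ⟨⟨⟨hcompat, hcompat₂⟩, hX⟩, hZ⟩ := hall i (by rw [hlen2]; exact hi)
  have hperm : permListOK c.n (perms.getD i []) = true := by
    simp only [Cover2.permCompatOK, Bool.and_eq_true] at hcompat; exact hcompat.1.1
  -- transport v by the upstairs table
  set v' := permWord (permFun (perms.getD i [])) v c.n with hv'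
  obtain ⟨hsyn', hnot'⟩ := bad_permWord hcomm hperm hX hZ hsyn hnot
  have hvlt' : v' < 2 ^ c.n := permWord_permFun_lt_two_pow hperm v
  have hwt' : popc c.n v' = popc c.n v := popc_permWord_permFun hperm v
  have hpush' : c₂.push (c.push v') = reps2.getD j 0 := by
    rw [hv', Cover2.push_permWord hc hcompat, ← hn, Cover2.push_permWord hc₂ hcompat₂, ← hs, hij]
  refine ⟨v', ⟨hvlt', hsyn', hnot', by rw [hwt']; exact hle⟩, Or.inr ?_⟩
  -- LEVEL 2→1 for the representative: u' := push v' is a listed candidate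
  obtain ⟨hker, hlam⟩ := hpushKer v' hvlt' hsyn'
  have hule : popc c.nq (c.push v') ≤ W := le_trans (Cover2.popc_push_le hc v') (by rw [hwt']; exact hle)
  exact hsub j hj _ (hprob2 j hj (c.push v') (c.push_lt _) hker hlam hpush' hule)

/-- The flat conclusion as a statement about VECTORS (the shape the route closers consume, e.g.
`Theorems/BB288DistanceCertificateLowerZOfFlat`): every `w : Fin n → 𝔽₂` in `ker H^X ∖ rowspace H^Z` has weight `> W`. -/
theorem flat_vec_of_flat_word {n : ℕ} {HX HZ : List ℕ} {W : ℕ}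
    (h : ∀ v : ℕ, v < 2 ^ n → synZero n HX v = true → ofBits n v ∉ rowSpace (rowMatrix n HZ) → W < popc n v)
    (w : Fin n → ZMod 2) (hw : rowMatrix n HX *ᵥ w = 0) (hw' : w ∉ rowSpace (rowMatrix n HZ)) :
    W < hammingNorm w := by
  obtain ⟨v, hv, rfl⟩ : ∃ v, v < 2 ^ n ∧ ofBits n v = w := ⟨toBits w, toBits_lt w, ofBits_toBits w⟩
  rw [hammingNorm_ofBits]
  exact h v hv ((synZero_iff _ _ _).2 hw) hw'

/-! ## T0′ (level 2→1 problems ⇒ `hprob2`) and the kernel-span hypotheses `hDq` from the core verdict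
(appended; nothing evaluated) -/

/-- **T0′.** A solved LEVEL-2→1 problem of the representative `u` against the AUGMENTED system
(`level_list_core_aug`) ⇒ every admissible `v` over `u` is one of the problem's generated words (`listGen`) — the
per-representative hypothesis `hprob2` of `cov_of_levels` with `cand2 := listGen c P u`. -/
theorem cand_of_levelListAug {c cr : Cover2} (hc : c.ok = true) (hcr : cr.ok = true) {H Hq Dq : List ℕ}
    (hrows : pushRowsOK c cr H Hq = true) (Lam : List ℕ)
    (hDq : ∀ z : Fin c.nq → ZMod 2, rowMatrix c.nq (Hq ++ Lam.map c.push) *ᵥ z = 0 →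
      z ∈ Submodule.span (ZMod 2) (Set.range fun i : Fin Dq.length => ofBits c.nq Dq[i]))
    {P : CosetProb} (hP : cosetOK c.nq (Hq ++ Lam.map c.push) Dq P = true) {u W : ℕ} (hU : P.U = u)
    (hσ : P.sigma = sigmaOf c cr H u + 2 ^ Hq.length * synWd c.n Lam (c.lift0 u))
    (hf : W ≤ 2 * P.f + popc c.nq u) :
    ∀ v : ℕ, v < 2 ^ c.n → synZero c.n H v = true → (∀ l ∈ Lam, popc c.n (l &&& v) % 2 = 0) →
      c.push v = u → popc c.n v ≤ W → v ∈ listGen c P u := by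
  intro v hv hsyn hann hpu hwt
  obtain ⟨a, ha, m, hm, e⟩ := level_list_core_aug hc hcr hrows Lam hDq hP hU hσ hf hv hsyn hann hpu hwt
  rw [e]
  exact mem_listGen ha hm

/-- **T0′, plain system** (`level_list_core`, no functionals). -/
theorem cand_of_levelList {c cr : Cover2} (hc : c.ok = true) (hcr : cr.ok = true) {H Hq Dq : List ℕ}
    (hrows : pushRowsOK c cr H Hq = true)
    (hDq : ∀ z : Fin c.nq → ZMod 2, rowMatrix c.nq Hq *ᵥ z = 0 →
      z ∈ Submodule.span (ZMod 2) (Set.range fun i : Fin Dq.length => ofBits c.nq Dq[i]))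
    {P : CosetProb} (hP : cosetOK c.nq Hq Dq P = true) {u W : ℕ} (hU : P.U = u)
    (hσ : P.sigma = sigmaOf c cr H u) (hf : W ≤ 2 * P.f + popc c.nq u) :
    ∀ v : ℕ, v < 2 ^ c.n → synZero c.n H v = true → c.push v = u → popc c.n v ≤ W → v ∈ listGen c P u := by
  intro v hv hsyn hpu hwt
  obtain ⟨a, ha, m, hm, e⟩ := level_list_core hc hcr hrows hDq hP hU hσ hf hv hsyn hpu hwt
  rw [e]
  exact mem_listGen ha hm

/-- **`hDq` from the core verdict**: with rank certificates, pairing and `n = r_X + r_Z + k` (type-10 `bzCoreOK`),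
`ker H^X ⊆ span (H^Z rows ++ logicals)` read on the word list `HZ ++ LZ` — the kernel-span hypothesis of
`coset_sound` / the level lemmas / T0 / T0′ (`Dq := HZ ++ LZ` of the level's code). -/
theorem ker_subset_span_of_core {n : ℕ} {HX HZ LZ LXd : List ℕ} {rcX rcZ : RankCert} {ew : Option (List ℕ)}
    (hcomm : rowMatrix n HX * (rowMatrix n HZ)ᵀ = 0) (hcore : bzCoreOK n HX HZ rcX rcZ LZ LXd ew = true) :
    ∀ z : Fin n → ZMod 2, rowMatrix n HX *ᵥ z = 0 →
      z ∈ Submodule.span (ZMod 2) (Set.range fun i : Fin (HZ ++ LZ).length => ofBits n (HZ ++ LZ)[i]) := by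
  intro z hz
  have hcore' := hcore
  simp only [bzCoreOK, Bool.and_eq_true, beq_iff_eq] at hcore'
  obtain ⟨⟨⟨⟨hY, hS⟩, hL⟩, hdim⟩, -⟩ := hcore'
  obtain ⟨a, ha⟩ := exists_coeffs_of_ker hcomm hY hS hL hdim hz
  set S := Submodule.span (ZMod 2) (Set.range fun i : Fin (HZ ++ LZ).length => ofBits n (HZ ++ LZ)[i]) with hSdef
  have hgen : ∀ i : ℕ, (hi : i < (HZ ++ LZ).length) → ofBits n (HZ ++ LZ)[i] ∈ S := fun i hi =>
    Submodule.subset_span ⟨⟨i, hi⟩, rfl⟩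
  have h1 : rowSpace (rowMatrix n HZ) ≤ S := by
    rw [rowSpace_rowMatrix_eq_span]
    refine Submodule.span_le.2 ?_
    rintro _ ⟨j, rfl⟩
    have hj : (j : ℕ) < (HZ ++ LZ).length := by
      rw [List.length_append]; exact Nat.lt_add_right _ j.2
    have e : (HZ ++ LZ)[(j : ℕ)] = HZ[(j : ℕ)] := List.getElem_append_left j.2
    have := hgen j hj
    rw [e] at this
    exact this
  have h2 : ∀ i : Fin LZ.length, logVec n LZ i ∈ S := by
    intro i
    have hi : HZ.length + i < (HZ ++ LZ).length := by
      rw [List.length_append]; exact Nat.add_lt_add_left i.2 _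
    have e : (HZ ++ LZ)[HZ.length + i] = LZ[(i : ℕ)] := by
      rw [List.getElem_append_right (Nat.le_add_right _ _)]
      simp only [Nat.add_sub_cancel_left]
    have := hgen _ hi
    rw [e] at this
    exact this
  rw [← sub_add_cancel z (∑ i, a i • logVec n LZ i)]
  exact S.add_mem (h1 ha) (S.sum_mem fun i _ => S.smul_mem _ (h2 i))

/-- The same for an AUGMENTED system `Hq ++ E` (its kernel lies in `ker Hq`). -/
theorem ker_subset_span_of_core_aug {n : ℕ} {HX HZ LZ LXd E : List ℕ} {rcX rcZ : RankCert} {ew : Option (List ℕ)}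
    (hcomm : rowMatrix n HX * (rowMatrix n HZ)ᵀ = 0) (hcore : bzCoreOK n HX HZ rcX rcZ LZ LXd ew = true) :
    ∀ z : Fin n → ZMod 2, rowMatrix n (HX ++ E) *ᵥ z = 0 →
      z ∈ Submodule.span (ZMod 2) (Set.range fun i : Fin (HZ ++ LZ).length => ofBits n (HZ ++ LZ)[i]) :=
  fun z hz => ker_subset_span_of_core hcomm hcore z (mulVec_append_left_eq_zero hz)


/-! ## Fast target syndromes (appended): `sigmaOfQ` / `synWdQ` on packed popcounts, for `hσ` at `n ≤ 496` -/

/-- Fast twin of `synWd` (packed popcounts `popcQ` of CertCheckParityFast; valid for words `< 2^496`). (definition) -/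
def synWdQ (H : List ℕ) (v : ℕ) : ℕ := mkBits H.length fun r => popcQ (H.getD r 0 &&& v) % 2 == 1

/-- Fast twin of the target syndrome `sigmaOf` of a coset problem (measured at `n = 288`: ≈ 1 s vs ≈ 4 s per
problem under `decide +kernel`). (definition) -/
def sigmaOfQ (c cr : Cover2) (H : List ℕ) (u : ℕ) : ℕ := descend cr (synWdQ H (c.lift0 u))

/-- `synWdQ = synWd` on words below `2^n`, `n ≤ 496`. -/
theorem synWdQ_eq {n : ℕ} (H : List ℕ) {v : ℕ} (hv : v < 2 ^ n) (hn : n ≤ 496) : synWdQ H v = synWd n H v := by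
  unfold synWdQ synWd synBit
  congr 1
  funext r
  rw [popcQ_eq (Nat.and_lt_two_pow _ hv) hn]

/-- `sigmaOfQ = sigmaOf` for covers with `n ≤ 496` qubits upstairs. -/
theorem sigmaOfQ_eq (c cr : Cover2) (H : List ℕ) (u : ℕ) (hn : c.n ≤ 496) :
    sigmaOfQ c cr H u = sigmaOf c cr H u := by
  unfold sigmaOfQ sigmaOf
  rw [synWdQ_eq H (c.lift0_lt u) hn]

/-- Reading a decided fast target syndrome as the `hσ` hypothesis of the level lemmas / T0 / T0′:
`hσ := sigma_eq_of_Q (by decide) (by decide +kernel)`. -/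
theorem sigma_eq_of_Q {c cr : Cover2} {H : List ℕ} {u s : ℕ} (hn : c.n ≤ 496) (h : sigmaOfQ c cr H u = s) :
    s = sigmaOf c cr H u := by
  rw [← h, sigmaOfQ_eq c cr H u hn]

/-- The augmented target of a level-2→1 problem, `σ(u) + 2^k · synWd n Λ (lift₀ u)`, from the fast twins. -/
theorem sigma_aug_eq_of_Q {c cr : Cover2} {H Lam : List ℕ} {u s k : ℕ} (hn : c.n ≤ 496)
    (h : sigmaOfQ c cr H u + 2 ^ k * synWdQ Lam (c.lift0 u) = s) :
    s = sigmaOf c cr H u + 2 ^ k * synWd c.n Lam (c.lift0 u) := by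
  rw [← h, sigmaOfQ_eq c cr H u hn, synWdQ_eq Lam (c.lift0_lt u) hn]

end Summit.Ventures.QEC.Census
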